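/-
Copyright (c) 2026 the pub-hodgecm-mathlib formalisation cell (harness21).  Prover seat hodgecm-mathlib-A-p19 (g20), D-T road (Tamagawa ∕ (K7-s)),
brick B1′ «D-T3′-def, CM non-degeneracy» (LEAD F0P3a-plan (g8) WORDS T7-79 ∕ T7-86, 2026-09-01).
-/
import Literature.NumberTheory.Weil1964.UnitaryArchTopFormHaar
import HarnessLib

/-!
# The trace form on `𝔲(J)` is non-degenerate in the CM situation — the hypothesis `hnd` of ★ `UnitaryArchTopFormHaar` discharged
# (Rogawski 1990 §1.7; Knapp 2002 I §1, VIII §2; Macdonald 1980)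

Topic `NumberTheory/Weil1964`; namespace `Literature.NumberTheory.Weil1964.UnitaryArchTopForm`.  THEOREMS ONLY (no definition, no instance, no notation, no named
fact, no `sorry`).  Cell `pub/hodgecm-mathlib`, crux H413 = `stmt-HodgeConjecture-24833`; D-T road row «D-T3′», brick B1′ over ★ B1 `UnitaryArchTopFormHaar`.

THE CM SITUATION: `c ≠ 1` fixes every infinite place of `E` (`hc`, `hfix` — then `E` is totally complex and `c ⊗ 1` is coordinatewise complex conjugation, ★
`isComplex_of_smul_eq`, ★ `evalC_conjMixed`), `J` is `c`-hermitian (`hherm : (J.map c)ᵀ = J`, the tree's spelling) with `det J ≠ 0` (`hJ`).  Then for `X ∈ 𝔲(J)`,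
`X ≠ 0`, the element `Y = X♮ − J′⁻¹ X J′` (`X♮ = archStar X`, `J′ = archFormOf J`) lies in `𝔲(J)` and `β(X, Y) = 2 ∑_w ‖X_w‖²_F > 0` (place by place: `X_w^* J_w = −J_w X_w`,
`J_w^* = J_w`, so `tr(X_w X_w^*) = ‖X_w‖²` and `tr(X_w J_w⁻¹ X_w J_w) = −tr(X_w^* X_w)`).  Hence the trace form is non-degenerate on `𝔲(J)`, `lieGramDet ≠ 0`, and ★ B1's
`isHaarMeasure_archTopFormHaar` ∕ `archTopFormHaar_restrict_window` hold with no hypothesis left (`…_of_isCM`).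
* §1 place-wise dictionary: `isEmpty_isReal`, `reTr_eq_sum`, `snd_trace`, `trace_map_evalC`, `traceForm_eq_sum`, `traceForm_comm`, `embedding_c_eq_conj`,
  `map_evalC_archStar`, `conjTranspose_map_embedding`, `map_evalC_of_mem_archSkew`, `eq_of_forall_map_evalC`, `mem_archSkew_of_forall_evalC`, `map_evalC_inv_archFormOf`;
* §2 the test element: `skewAdjoint_mem_archSkew`, `traceForm_skewAdjoint_eq`, `traceForm_skewAdjoint_pos`;
* §3 **`traceForm_nondegenerate`**, **`lieGramDet_ne_zero`**, `isHaarMeasure_archTopFormHaar_of_isCM`, `archTopFormHaar_restrict_window_of_isCM`.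
HONEST SCOPE.  Linear algebra place by place (Mathlib + ★ `UnitaryGroupArchimedean`'s `evalC` dictionary).  HC_CM is proved only modulo the printed citations until rung 0
closes; this file discharges no printed statement.

## References
* J. D. Rogawski, *Automorphic Representations of Unitary Groups in Three Variables*, Ann. of Math. Stud. 123 (1990), §1.7 p. 6. [Rogawski1990]
* A. W. Knapp, *Lie Groups Beyond an Introduction*, 2nd ed. (2002), I §1 (the classical real forms `𝔲(p,q)`), VIII §2. [Knapp2002]
* I. G. Macdonald, *The volume of a compact Lie group*, Invent. Math. 56 (1980), 93–95. [Macdonald1980]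
-/

set_option autoImplicit false
-- the scoped normed structure on the submodule `𝔲 ≤ M_N(E ⊗ ℝ)` vs the `[BorelSpace ↥(archSkew …)]` binder's subtype topology (as in ★ B1 ∕ ★ B5b)
set_option backward.isDefEq.respectTransparency false

noncomputable section

open NumberField NumberField.mixedEmbedding NumberField.InfinitePlace Set Filter Topology MeasureTheory MeasureTheory.Measure
open Literature.NumberTheory.Automorphic Literature.NumberTheory.Automorphic.UnitaryGroup
open scoped Classical Matrix Matrix.Norms.Operator MatrixGroups ENNReal NNReal Pointwise ComplexConjugate ComplexOrder

namespace Literature.NumberTheory.Weil1964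

namespace UnitaryArchTopForm

section CM

variable (F E : Type) [Field F] [Field E] [NumberField E] [Algebra F E] (c : E ≃ₐ[F] E) (N : ℕ) (J : Matrix (Fin N) (Fin N) E)

variable {F E c N}

/-! ## §1 The place-wise dictionary -/

omit [NumberField E] in
/-- In the CM situation there is no real place. [cite: Knapp2002, I §1] -/
theorem isEmpty_isReal (hc : c ≠ 1) (hfix : ∀ w : InfinitePlace E, c • w = w) : IsEmpty {w : InfinitePlace E // IsReal w} :=
  ⟨fun w => not_isReal_iff_isComplex.mpr (isComplex_of_smul_eq F E c hc (hfix w.1)) w.2⟩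

/-- `reTr x = ∑_{w complex} Re x_w` in the CM situation. [cite: Rogawski1990, §1.7 p. 6] -/
theorem reTr_eq_sum (hc : c ≠ 1) (hfix : ∀ w : InfinitePlace E, c • w = w) (x : mixedSpace E) :
    reTr E x = ∑ w : {w : InfinitePlace E // IsComplex w}, (x.2 w).re := by
  haveI := isEmpty_isReal (F := F) (E := E) hc hfix
  show ∑ w, x.1 w + ∑ w, (x.2 w).re = _
  rw [Finset.univ_eq_empty, Finset.sum_empty, zero_add]

omit [NumberField E] in
/-- The `w`-coordinate of a trace is the trace of the `w`-coordinates. [cite: Knapp2002, I §1] -/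
theorem trace_map_evalC (X : Matrix (Fin N) (Fin N) (mixedSpace E)) (w : {w : InfinitePlace E // IsComplex w}) :
    Matrix.trace (X.map (evalC E w)) = (Matrix.trace X).2 w := by
  simp only [Matrix.trace, Matrix.diag_apply, Matrix.map_apply, evalC_apply, Prod.snd_sum, Finset.sum_apply]

/-- **The trace form place by place**: `β(X, Y) = ∑_w Re tr(X_w Y_w)` in the CM situation. [cite: Rogawski1990, §1.7 p. 6] [cite: Macdonald1980, p. 93] -/
theorem traceForm_eq_sum (hc : c ≠ 1) (hfix : ∀ w : InfinitePlace E, c • w = w) (X Y : Matrix (Fin N) (Fin N) (mixedSpace E)) :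
    traceForm E N X Y = ∑ w : {w : InfinitePlace E // IsComplex w}, (Matrix.trace (X.map (evalC E w) * Y.map (evalC E w))).re := by
  rw [traceForm_apply, reTr_eq_sum (F := F) (c := c) hc hfix]
  refine Finset.sum_congr rfl fun w _ => ?_
  rw [← Matrix.map_mul, trace_map_evalC]

/-- The trace form is symmetric. [cite: Macdonald1980, p. 93] -/
theorem traceForm_comm (X Y : Matrix (Fin N) (Fin N) (mixedSpace E)) : traceForm E N X Y = traceForm E N Y X := by
  rw [traceForm_apply, traceForm_apply, Matrix.trace_mul_comm]

omit [NumberField E] in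
/-- At a complex place fixed by `c ≠ 1`, `σ_w ∘ c = conj ∘ σ_w`. [cite: Knapp2002, I §1] -/
theorem embedding_c_eq_conj (hc : c ≠ 1) {w : {w : InfinitePlace E // IsComplex w}} (hw : c • w.1 = w.1) (x : E) :
    w.1.embedding (c x) = starRingEnd ℂ (w.1.embedding x) := by
  have h := conjCoord_embedding F E c w x
  rw [conjCoord_eq_conj F E c hw hc, hw] at h
  exact h.symm

omit [NumberField E] in
/-- `(X♮)_w = (X_w)^*` in the CM situation. [cite: Knapp2002, I §1] -/
theorem map_evalC_archStar (hc : c ≠ 1) (hfix : ∀ w : InfinitePlace E, c • w = w) (X : Matrix (Fin N) (Fin N) (mixedSpace E))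
    (w : {w : InfinitePlace E // IsComplex w}) : (archStar F E c N X).map (evalC E w) = (X.map (evalC E w))ᴴ := by
  have hfun : (⇑(evalC E w) ∘ ⇑(conjMixed F E c)) = (star ∘ ⇑(evalC E w)) := funext fun x => evalC_conjMixed F E c (hfix w.1) hc x
  rw [archStar_apply, Matrix.transpose_map, Matrix.map_map, hfun, Matrix.conjTranspose, Matrix.transpose_map, Matrix.map_map]

omit [NumberField E] in
/-- `J_w^* = J_w` for a `c`-hermitian `J` in the CM situation. [cite: Knapp2002, I §1] -/
theorem conjTranspose_map_embedding (hc : c ≠ 1) (hfix : ∀ w : InfinitePlace E, c • w = w) (hherm : (J.map c)ᵀ = J)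
    (w : {w : InfinitePlace E // IsComplex w}) : (J.map w.1.embedding)ᴴ = J.map w.1.embedding := by
  have hfun : (star ∘ ⇑(w.1.embedding) : E → ℂ) = ⇑(w.1.embedding) ∘ ⇑c :=
    funext fun x => (embedding_c_eq_conj (F := F) hc (hfix w.1) x).symm
  conv_rhs => rw [← hherm]
  rw [Matrix.conjTranspose, Matrix.transpose_map, Matrix.map_map, hfun, ← Matrix.map_map, Matrix.transpose_map]

omit [NumberField E] in
/-- Membership in `𝔲(J)` read at a complex place: `X_w^* J_w + J_w X_w = 0`. [cite: Knapp2002, I §1] -/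
theorem map_evalC_of_mem_archSkew (hc : c ≠ 1) (hfix : ∀ w : InfinitePlace E, c • w = w) {X : Matrix (Fin N) (Fin N) (mixedSpace E)}
    (hX : X ∈ archSkew F E c N J) (w : {w : InfinitePlace E // IsComplex w}) :
    (X.map (evalC E w))ᴴ * J.map w.1.embedding + J.map w.1.embedding * X.map (evalC E w) = 0 := by
  have key := congrArg (evalC E w).mapMatrix ((mem_archSkew_iff J X).1 hX)
  rw [map_add, map_mul, map_mul, map_zero, RingHom.mapMatrix_apply, RingHom.mapMatrix_apply, RingHom.mapMatrix_apply,
    map_evalC_archStar (F := F) (c := c) hc hfix, archFormOf_map_evalC] at key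
  exact key

omit [NumberField E] in
/-- Two matrices over `E ⊗ ℝ` agree iff they agree at every complex place (CM situation: no real place). [cite: Knapp2002, I §1] -/
theorem eq_of_forall_map_evalC (hc : c ≠ 1) (hfix : ∀ w : InfinitePlace E, c • w = w) {X Y : Matrix (Fin N) (Fin N) (mixedSpace E)}
    (h : ∀ w : {w : InfinitePlace E // IsComplex w}, X.map (evalC E w) = Y.map (evalC E w)) : X = Y := by
  have hE := isEmpty_isReal (F := F) (E := E) hc hfix
  refine Matrix.ext fun i j => Prod.ext (funext fun w => hE.elim w) (funext fun w => ?_)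
  have := congrFun (congrFun (h w) i) j
  simpa only [Matrix.map_apply, evalC_apply] using this

omit [NumberField E] in
/-- Membership in `𝔲(J)` from the place-wise identities. [cite: Knapp2002, I §1] -/
theorem mem_archSkew_of_forall_evalC (hc : c ≠ 1) (hfix : ∀ w : InfinitePlace E, c • w = w) {X : Matrix (Fin N) (Fin N) (mixedSpace E)}
    (h : ∀ w : {w : InfinitePlace E // IsComplex w}, (X.map (evalC E w))ᴴ * J.map w.1.embedding + J.map w.1.embedding * X.map (evalC E w) = 0) :
    X ∈ archSkew F E c N J := by
  rw [mem_archSkew_iff]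
  refine eq_of_forall_map_evalC (F := F) (c := c) hc hfix fun w => ?_
  show (evalC E w).mapMatrix _ = (evalC E w).mapMatrix 0
  rw [map_add, map_mul, map_mul, map_zero, RingHom.mapMatrix_apply, RingHom.mapMatrix_apply, RingHom.mapMatrix_apply,
    map_evalC_archStar (F := F) (c := c) hc hfix, archFormOf_map_evalC]
  exact h w

omit [NumberField E] in
/-- `(J′⁻¹)_w = J_w⁻¹` for `det J ≠ 0`. [cite: Knapp2002, I §1] -/
theorem map_evalC_inv_archFormOf (hJ : IsUnit J.det) (w : {w : InfinitePlace E // IsComplex w}) :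
    (archFormOf E N J)⁻¹.map (evalC E w) = (J.map w.1.embedding)⁻¹ := by
  have hdet : IsUnit (archFormOf E N J).det := by
    have h := hJ.map (mixedEmbedding E)
    rw [RingHom.map_det (mixedEmbedding E) J] at h
    exact h
  symm
  refine Matrix.inv_eq_left_inv ?_
  have h1 : ((archFormOf E N J)⁻¹ * archFormOf E N J).map (evalC E w) = 1 := by
    rw [Matrix.nonsing_inv_mul _ hdet, Matrix.map_one _ (map_zero _) (map_one _)]
  rwa [Matrix.map_mul, archFormOf_map_evalC] at h1

/-! ## §2 The test element `X♮ − J′⁻¹ X J′` -/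

omit [NumberField E] in
/-- The test element read at a complex place: `(X♮ − J′⁻¹ X J′)_w = X_w^* − J_w⁻¹ X_w J_w` (CM situation, `det J ≠ 0`). [cite: Knapp2002, I §1] -/
theorem map_evalC_skewAdjoint (hc : c ≠ 1) (hfix : ∀ w : InfinitePlace E, c • w = w) (hJ : IsUnit J.det) (X : Matrix (Fin N) (Fin N) (mixedSpace E))
    (w : {w : InfinitePlace E // IsComplex w}) :
    (archStar F E c N X - (archFormOf E N J)⁻¹ * X * archFormOf E N J).map (evalC E w) =
      (X.map (evalC E w))ᴴ - (J.map w.1.embedding)⁻¹ * X.map (evalC E w) * J.map w.1.embedding := by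
  show (evalC E w).mapMatrix _ = _
  rw [map_sub, map_mul, map_mul, RingHom.mapMatrix_apply, RingHom.mapMatrix_apply, RingHom.mapMatrix_apply, RingHom.mapMatrix_apply,
    map_evalC_archStar (F := F) (c := c) hc hfix, map_evalC_inv_archFormOf J hJ, archFormOf_map_evalC]

omit [NumberField E] in
/-- For `X ∈ 𝔲(J)`: `Y = X♮ − J′⁻¹ X J′ ∈ 𝔲(J)` (CM situation, `J` hermitian with `det J ≠ 0`). [cite: Knapp2002, I §1] -/
theorem skewAdjoint_mem_archSkew (hc : c ≠ 1) (hfix : ∀ w : InfinitePlace E, c • w = w) (hherm : (J.map c)ᵀ = J) (hJ : IsUnit J.det)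
    {X : Matrix (Fin N) (Fin N) (mixedSpace E)} (hX : X ∈ archSkew F E c N J) :
    archStar F E c N X - (archFormOf E N J)⁻¹ * X * archFormOf E N J ∈ archSkew F E c N J := by
  refine mem_archSkew_of_forall_evalC (F := F) (c := c) J hc hfix fun w => ?_
  have hXw := map_evalC_of_mem_archSkew (F := F) (c := c) J hc hfix hX w
  have hJw := conjTranspose_map_embedding (F := F) (c := c) J hc hfix hherm w
  rw [map_evalC_skewAdjoint (F := F) (c := c) J hc hfix hJ X w]
  set Xw := X.map (evalC E w) with hXwdef
  set Jw := J.map w.1.embedding with hJwdef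
  have hdet : IsUnit Jw.det := by
    have h := hJ.map w.1.embedding
    rw [RingHom.map_det w.1.embedding J] at h
    exact h
  have hinv : Jw⁻¹ * Jw = 1 := Matrix.nonsing_inv_mul _ hdet
  have hinv' : Jw * Jw⁻¹ = 1 := Matrix.mul_nonsing_inv _ hdet
  have hJinvH : (Jw⁻¹)ᴴ = Jw⁻¹ := by rw [Matrix.conjTranspose_nonsing_inv, hJw]
  -- `X_w^* = -J_w X_w J_w⁻¹`
  have hXH : Xwᴴ = -(Jw * Xw * Jw⁻¹) := by
    have := congrArg (fun A => A * Jw⁻¹) hXw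
    simp only [add_mul, zero_mul] at this
    rw [Matrix.mul_assoc Xwᴴ, hinv', Matrix.mul_one] at this
    rw [eq_neg_iff_add_eq_zero]; exact this
  rw [Matrix.conjTranspose_sub, Matrix.conjTranspose_conjTranspose, Matrix.conjTranspose_mul, Matrix.conjTranspose_mul, hJw, hJinvH, hXH]
  simp only [Matrix.neg_mul, Matrix.mul_neg, Matrix.sub_mul, Matrix.mul_sub, Matrix.mul_assoc, hinv, Matrix.mul_one]
  rw [← Matrix.mul_assoc Jw Jw⁻¹, hinv', Matrix.one_mul]
  abel

/-- **`β(X, X♮ − J′⁻¹ X J′) = 2 ∑_w ∑_{ij} ‖(X_w)_{ij}‖²`** for `X ∈ 𝔲(J)` (CM situation). [cite: Macdonald1980, p. 93] [cite: Knapp2002, I §1] -/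
theorem traceForm_skewAdjoint_eq (hc : c ≠ 1) (hfix : ∀ w : InfinitePlace E, c • w = w) (hherm : (J.map c)ᵀ = J) (hJ : IsUnit J.det)
    {X : Matrix (Fin N) (Fin N) (mixedSpace E)} (hX : X ∈ archSkew F E c N J) :
    traceForm E N X (archStar F E c N X - (archFormOf E N J)⁻¹ * X * archFormOf E N J) =
      2 * ∑ w : {w : InfinitePlace E // IsComplex w}, ∑ i, ∑ j, ‖X.map (evalC E w) i j‖ ^ 2 := by
  rw [traceForm_eq_sum (F := F) (c := c) hc hfix, Finset.mul_sum]
  refine Finset.sum_congr rfl fun w _ => ?_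
  have hXw := map_evalC_of_mem_archSkew (F := F) (c := c) J hc hfix hX w
  have hJw := conjTranspose_map_embedding (F := F) (c := c) J hc hfix hherm w
  rw [map_evalC_skewAdjoint (F := F) (c := c) J hc hfix hJ X w]
  set Xw := X.map (evalC E w) with hXwdef
  set Jw := J.map w.1.embedding with hJwdef
  have hdet : IsUnit Jw.det := by
    have h := hJ.map w.1.embedding
    rw [RingHom.map_det w.1.embedding J] at h
    exact h
  have hinv' : Jw * Jw⁻¹ = 1 := Matrix.mul_nonsing_inv _ hdet
  -- `J_w X_w J_w⁻¹ = -X_w^*`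
  have hXH : Jw * Xw * Jw⁻¹ = -Xwᴴ := by
    have := congrArg (fun A => A * Jw⁻¹) hXw
    simp only [add_mul, zero_mul] at this
    rw [Matrix.mul_assoc Xwᴴ, hinv', Matrix.mul_one] at this
    rw [eq_neg_iff_add_eq_zero, add_comm]; exact this
  rw [Matrix.mul_sub, Matrix.trace_sub]
  -- cyclicity: `tr(X (J⁻¹ X J)) = tr(J X J⁻¹ X) = -tr(X^* X)`
  have hcyc : Matrix.trace (Xw * (Jw⁻¹ * Xw * Jw)) = Matrix.trace (Jw * Xw * Jw⁻¹ * Xw) := by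
    rw [show Xw * (Jw⁻¹ * Xw * Jw) = (Xw * Jw⁻¹ * Xw) * Jw by simp only [Matrix.mul_assoc], Matrix.trace_mul_comm,
      show Jw * (Xw * Jw⁻¹ * Xw) = Jw * Xw * Jw⁻¹ * Xw by simp only [Matrix.mul_assoc]]
  rw [hcyc, hXH, Matrix.neg_mul, Matrix.trace_neg, sub_neg_eq_add, Matrix.trace_mul_comm Xwᴴ]
  -- `tr(X X^*) = ∑ ‖X_ij‖²`, a real number
  have htr : Matrix.trace (Xw * Xwᴴ) = ((∑ i, ∑ j, ‖Xw i j‖ ^ 2 : ℝ) : ℂ) := by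
    simp only [Matrix.trace, Matrix.diag_apply, Matrix.mul_apply, Matrix.conjTranspose_apply, Complex.star_def, Complex.mul_conj,
      Complex.normSq_eq_norm_sq, Complex.ofReal_sum, Complex.ofReal_pow]
  rw [htr, ← two_mul, ← Complex.ofReal_ofNat, ← Complex.ofReal_mul, Complex.ofReal_re]

/-- **Positivity**: `0 < β(X, X♮ − J′⁻¹ X J′)` for `X ∈ 𝔲(J)`, `X ≠ 0` (CM situation). [cite: Macdonald1980, p. 93] [cite: Knapp2002, I §1] -/
theorem traceForm_skewAdjoint_pos (hc : c ≠ 1) (hfix : ∀ w : InfinitePlace E, c • w = w) (hherm : (J.map c)ᵀ = J) (hJ : IsUnit J.det)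
    {X : Matrix (Fin N) (Fin N) (mixedSpace E)} (hX : X ∈ archSkew F E c N J) (hX0 : X ≠ 0) :
    0 < traceForm E N X (archStar F E c N X - (archFormOf E N J)⁻¹ * X * archFormOf E N J) := by
  rw [traceForm_skewAdjoint_eq (F := F) (c := c) J hc hfix hherm hJ hX]
  refine mul_pos two_pos ?_
  -- some coordinate of `X` at some complex place is non-zero
  obtain ⟨w, i, j, hne⟩ : ∃ (w : {w : InfinitePlace E // IsComplex w}) (i j : Fin N), X.map (evalC E w) i j ≠ 0 := by
    by_contra hall
    push Not at hall
    exact hX0 (eq_of_forall_map_evalC (F := F) (c := c) hc hfix fun w => by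
      ext i j; rw [hall w i j, Matrix.map_apply, Matrix.zero_apply, map_zero])
  have hle : ‖X.map (evalC E w) i j‖ ^ 2 ≤ ∑ w : {w : InfinitePlace E // IsComplex w}, ∑ i, ∑ j, ‖X.map (evalC E w) i j‖ ^ 2 := by
    refine le_trans ?_ (Finset.single_le_sum (f := fun w => ∑ i, ∑ j, ‖X.map (evalC E w) i j‖ ^ 2)
      (fun w _ => Finset.sum_nonneg fun i _ => Finset.sum_nonneg fun j _ => sq_nonneg _) (Finset.mem_univ w))
    refine le_trans ?_ (Finset.single_le_sum (f := fun i => ∑ j, ‖X.map (evalC E w) i j‖ ^ 2)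
      (fun i _ => Finset.sum_nonneg fun j _ => sq_nonneg _) (Finset.mem_univ i))
    exact Finset.single_le_sum (f := fun j => ‖X.map (evalC E w) i j‖ ^ 2) (fun j _ => sq_nonneg _) (Finset.mem_univ j)
  exact lt_of_lt_of_le (pow_pos (norm_pos_iff.2 hne) 2) hle

/-! ## §3 Non-degeneracy and the discharge of `hnd` -/

/-- **THE TRACE FORM IS NON-DEGENERATE ON `𝔲(J)`** (CM situation, `J` hermitian, `det J ≠ 0`): `β(X, Y) = 0` for all `Y ∈ 𝔲(J)` forces `X = 0`.
[cite: Macdonald1980, p. 93] [cite: Knapp2002, I §1] -/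
theorem traceForm_nondegenerate (hc : c ≠ 1) (hfix : ∀ w : InfinitePlace E, c • w = w) (hherm : (J.map c)ᵀ = J) (hJ : IsUnit J.det)
    {X : archSkew F E c N J}
    (h : ∀ Y : archSkew F E c N J, traceForm E N (X : Matrix (Fin N) (Fin N) (mixedSpace E)) (Y : Matrix (Fin N) (Fin N) (mixedSpace E)) = 0) :
    X = 0 := by
  by_contra hX0
  have hX0' : (X : Matrix (Fin N) (Fin N) (mixedSpace E)) ≠ 0 := fun h0 => hX0 (Subtype.ext h0)
  have hpos := traceForm_skewAdjoint_pos (F := F) (c := c) J hc hfix hherm hJ X.2 hX0'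
  rw [h ⟨_, skewAdjoint_mem_archSkew (F := F) (c := c) J hc hfix hherm hJ X.2⟩] at hpos
  exact lt_irrefl _ hpos

/-- **`lieGramDet ≠ 0` IN THE CM SITUATION** — the hypothesis `hnd` of ★ `isHaarMeasure_archTopFormHaar` ∕ ★ `archTopFormHaar_restrict_window` discharged: the Gram
matrix of a non-degenerate form on a basis is invertible. [cite: Macdonald1980, p. 93] [cite: Knapp2002, VIII §2] -/
theorem lieGramDet_ne_zero (hc : c ≠ 1) (hfix : ∀ w : InfinitePlace E, c • w = w) (hherm : (J.map c)ᵀ = J) (hJ : IsUnit J.det) :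
    lieGramDet F E c N J ≠ 0 := by
  intro hdet
  set B := lieFinBasis F E c N J with hB
  obtain ⟨v, hv0, hv⟩ := (Matrix.exists_mulVec_eq_zero_iff (M := lieGram J B)).2 hdet
  -- `X := ∑ v i • B i` is non-zero and `β(B j, X) = 0` for every `j`
  set X : archSkew F E c N J := ∑ i, v i • B i with hXdef
  have hX0 : X ≠ 0 := by
    intro h0
    apply hv0
    have hli := B.linearIndependent
    rw [Fintype.linearIndependent_iff] at hli
    exact funext fun i => hli v h0 i
  have hcoe : (X : Matrix (Fin N) (Fin N) (mixedSpace E)) = ∑ i, v i • (B i : Matrix (Fin N) (Fin N) (mixedSpace E)) := by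
    rw [hXdef, Submodule.coe_sum]; rfl
  have hBX : ∀ j, traceForm E N (B j : Matrix (Fin N) (Fin N) (mixedSpace E)) (X : Matrix (Fin N) (Fin N) (mixedSpace E)) = 0 := by
    intro j
    have hj := congrFun hv j
    rw [Pi.zero_apply, Matrix.mulVec, dotProduct] at hj
    rw [hcoe, _root_.map_sum]
    simpa only [map_smul, smul_eq_mul, lieGram_apply, mul_comm (v _)] using hj
  -- hence `β(X, Y) = 0` for every `Y ∈ 𝔲(J)` (expand `Y` in the basis; symmetry), so `X = 0`
  refine hX0 (traceForm_nondegenerate (F := F) (c := c) J hc hfix hherm hJ fun Y => ?_)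
  have hY : (Y : Matrix (Fin N) (Fin N) (mixedSpace E)) = ∑ j, B.repr Y j • (B j : Matrix (Fin N) (Fin N) (mixedSpace E)) := by
    conv_lhs => rw [← B.sum_repr Y]
    rw [Submodule.coe_sum]; rfl
  rw [traceForm_comm, hY, _root_.map_sum, LinearMap.sum_apply]
  refine Finset.sum_eq_zero fun j _ => ?_
  rw [LinearMap.map_smul, LinearMap.smul_apply, hBX j, smul_zero]

variable [MeasurableSpace (archSkew F E c N J)] [BorelSpace (archSkew F E c N J)] [MeasurableSpace (arch F E c N J)] [BorelSpace (arch F E c N J)]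

/-- **`archTopFormHaar J` IS A HAAR MEASURE — CM situation, no hypothesis left.** [cite: Rogawski1990, §1.7 p. 6] [cite: Helgason2000, Ch. I §1 Thm. 1.14 p. 96] -/
theorem isHaarMeasure_archTopFormHaar_of_isCM (hc : c ≠ 1) (hfix : ∀ w : InfinitePlace E, c • w = w) (hherm : (J.map c)ᵀ = J) (hJ : IsUnit J.det) :
    (archTopFormHaar F E c N J).IsHaarMeasure :=
  isHaarMeasure_archTopFormHaar J (lieGramDet_ne_zero (F := F) (c := c) J hc hfix hherm hJ)

/-- **THE WINDOW IDENTITY — CM situation, no hypothesis left**: `(archTopFormHaar J)|_{ĉ(V₀)} = ĉ_*(w₀ · lieStdLebesgue J|_{V₀})`.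
[cite: Rogawski1990, §1.7 p. 6] [cite: Helgason2000, Ch. I §1 Thm. 1.14 (13) p. 96] -/
theorem archTopFormHaar_restrict_window_of_isCM (hc : c ≠ 1) (hfix : ∀ w : InfinitePlace E, c • w = w) (hherm : (J.map c)ᵀ = J) (hJ : IsUnit J.det) :
    (archTopFormHaar F E c N J).restrict (cayleyChart F E c N J '' window F E c N J) =
      cayleyChartMeasure F E c N J (lieStdLebesgue F E c N J) (window F E c N J) :=
  archTopFormHaar_restrict_window J (lieGramDet_ne_zero (F := F) (c := c) J hc hfix hherm hJ)

end CM

end UnitaryArchTopForm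

end Literature.NumberTheory.Weil1964

end
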